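import Summits.ABC.ABC.Theses.RibetTakahashiSplit
import Literature.NumberTheory.DiophantineGeometry.ConductorRadicalProofs
import Literature.NumberTheory.DiophantineGeometry.PastenValuationProductsProofs
import Literature.NumberTheory.EllipticCurves.PastenValuationProduct

/-!
# Stub `stub_depthSemistable` of line `switching-triangle` (crux stmt-ABC-1563): conditional discharge

Helper (`--supports stmt-ABC-1563`) for the registered stub

  `stub_depthSemistable : ∀ W [IsElliptic], Squarefree N → MP(W).Nonempty → G(W) ≤ 5`

of the line `switching-triangle` for the crux
`Summit.ABC.ABC.Theses.RibetTakahashiSplit.FewPrimeValuationProduct`, where `N = N_E` is the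
conductor, `MP(W) = {p ∣ N : p² ∤ N}` the set of multiplicative primes, `c_p = ord_p(Δ_min)` and
the DEPTH `G(W) = gcd_{p ∈ MP(W)} c_p`.

For `N` squarefree (i.e. `E` semistable, `WeierstrassCurve.isSemistable_iff_squarefree_conductorNorm`)
every bad prime is multiplicative and `primeFactors N = primeFactors Δ_min`
(`WeierstrassCurve.radical_conductorNorm_eq_holds`), so `G ∣ c_p` for every `p ∣ Δ_min` and
`Δ_min = (∏_p p^{c_p / G})^G = k^G` with `k ≥ 2` as soon as there is a bad prime
(`depthSemistable_pow`, PROVED). Mestre–Oesterlé's Théorème 1 (J. reine angew. Math. 400 (1989),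
p. 176; the tree's UNPROVED named fact
`Literature.NumberTheory.EllipticCurves.mestreOesterle1989_thm_1`: a semistable `E/ℚ` whose
minimal discriminant is an `m`-th power has `m ≤ 5`) then gives `G ≤ 5`. No discharge
`mestreOesterle1989_thm_1_holds` exists in the tree (Mazur, Ribet, modularity are not formalised),
so the stub is landed in its CONDITIONAL form, registered as the sub-goal
`stub_depthSemistable_of_mestreOesterle`, and closes the moment Théorème 1 is discharged.

Also here, the PRIME-CONDUCTOR face modulo the weaker named fact
`Literature.NumberTheory.EllipticCurves.mestreOesterle_factorization_le_five` ("`N_E = p` prime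
`⟹ v_p(Δ_E) ≤ 5`", Mestre–Oesterlé Thm 1 for prime conductor = Knapp Thm 12.11): for `N = p`
prime `MP(W) = {p}` and `G = c_p ≤ 5` (`depthSemistable_prime_of_factorization_le_five`).

Not here: any restatement of the named facts, any attempt at the unconditional statement.
-/

-- `Summit.<Summit>.<Problem>` is the mandated summit-side namespace (CONVENTIONS §2); for the
-- single-conjunct summit `ABC` the two coincide, so the duplicate `ABC.ABC` is deliberate.
set_option linter.dupNamespace false

namespace Summit.ABC.ABC.Theorems.FewPrimeValuationProduct

/-- For `N` squarefree, every prime factor of `N` is a multiplicative prime: the filter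
`{p ∣ N : p² ∤ N}` is all of `primeFactors N`. `[folklore]` -/
theorem depthSemistable_filter_eq (W : WeierstrassCurve ℚ) (hsq : Squarefree (W.conductorNorm ℤ)) :
    (W.conductorNorm ℤ).primeFactors.filter (fun p => ¬ p ^ 2 ∣ W.conductorNorm ℤ) =
      (W.conductorNorm ℤ).primeFactors := by
  apply Finset.filter_true_of_mem
  intro p hp h2
  have hp' : p.Prime := Nat.prime_of_mem_primeFactors hp
  exact (Nat.squarefree_iff_prime_squarefree.mp hsq) p hp' (by simpa [sq] using h2)

/-- The bad primes are the primes of the minimal discriminant: `primeFactors N = primeFactors Δ_min`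
(equality of radicals, `WeierstrassCurve.radical_conductorNorm_eq_holds`, Silverman AEC VIII.11).
`[folklore]` -/
theorem depthSemistable_primeFactors_eq (W : WeierstrassCurve ℚ) [W.IsElliptic] :
    (W.conductorNorm ℤ).primeFactors = (W.minimalDiscriminantNorm ℤ).primeFactors := by
  have hrad : UniqueFactorizationMonoid.radical (W.conductorNorm ℤ) =
      UniqueFactorizationMonoid.radical (W.minimalDiscriminantNorm ℤ) :=
    W.radical_conductorNorm_eq_holds
  rw [← Nat.primeFactors_radical, hrad, Nat.primeFactors_radical]

/-- **The arithmetic core (PROVED).** For `N` squarefree with at least one bad prime, the minimal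
discriminant is a `G`-th power of an integer `k ≥ 2`, where
`G = gcd_{p ∣ N, p² ∤ N} ord_p(Δ_min)` is the depth: `G ∣ c_p` for every `p ∣ Δ_min`
(`primeFactors N = primeFactors Δ_min`), so `Δ_min = ∏ p^{c_p} = (∏ p^{c_p/G})^G`, and the base
is `≥ a ≥ 2` for any bad prime `a` (its exponent `c_a / G` is `≥ 1`). `[folklore]` -/
theorem depthSemistable_pow (W : WeierstrassCurve ℚ) [W.IsElliptic]
    (hsq : Squarefree (W.conductorNorm ℤ))
    (hS : ((W.conductorNorm ℤ).primeFactors.filter (fun p => ¬ p ^ 2 ∣ W.conductorNorm ℤ)).Nonempty) :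
    ∃ k : ℕ, 2 ≤ k ∧ W.minimalDiscriminantNorm ℤ =
      k ^ ((W.conductorNorm ℤ).primeFactors.filter (fun p => ¬ p ^ 2 ∣ W.conductorNorm ℤ)).gcd
        (fun p => (W.minimalDiscriminantNorm ℤ).factorization p) := by
  classical
  set N := W.conductorNorm ℤ with hN
  set Δ := W.minimalDiscriminantNorm ℤ with hΔ
  set MP : Finset ℕ := N.primeFactors.filter (fun p => ¬ p ^ 2 ∣ N) with hMPdef
  have hmult : MP = N.primeFactors := depthSemistable_filter_eq W hsq
  have hpf : N.primeFactors = Δ.primeFactors := depthSemistable_primeFactors_eq W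
  set G : ℕ := MP.gcd (fun p => Δ.factorization p) with hGdef
  have hGdvd : ∀ p ∈ Δ.primeFactors, G ∣ Δ.factorization p := by
    intro p hp
    have hp' : p ∈ MP := by rw [hmult, hpf]; exact hp
    exact Finset.gcd_dvd hp'
  obtain ⟨a, ha⟩ := hS
  have haΔ : a ∈ Δ.primeFactors := by rw [← hpf, ← hmult]; exact ha
  have hca : 1 ≤ Δ.factorization a := by
    obtain ⟨hpp, hpd, hne⟩ := Nat.mem_primeFactors.mp haΔ
    exact hpp.factorization_pos_of_dvd hne hpd
  have hG1 : 1 ≤ G := by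
    rcases Nat.eq_zero_or_pos G with h0 | h0
    · have h0' : Δ.factorization a = 0 := (Finset.gcd_eq_zero_iff.mp h0) a ha
      omega
    · exact h0
  have hΔ0 : Δ ≠ 0 := by
    intro h0
    rw [h0, Nat.primeFactors_zero] at haΔ
    simp at haΔ
  set k := ∏ p ∈ Δ.primeFactors, p ^ (Δ.factorization p / G) with hk
  have hΔk : Δ = k ^ G := by
    conv_lhs => rw [← Nat.prod_factorization_pow_eq_self hΔ0]
    rw [Nat.prod_factorization_eq_prod_primeFactors, hk, ← Finset.prod_pow]
    refine Finset.prod_congr rfl fun p hp => ?_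
    rw [← pow_mul, Nat.div_mul_cancel (hGdvd p hp)]
  have hk2 : 2 ≤ k := by
    have hterm : ∀ p ∈ Δ.primeFactors, 1 ≤ p ^ (Δ.factorization p / G) := fun p hp =>
      Nat.one_le_pow _ _ (Nat.prime_of_mem_primeFactors hp).pos
    have hdiv : 1 ≤ Δ.factorization a / G :=
      (Nat.one_le_div_iff hG1).mpr (Nat.le_of_dvd hca (hGdvd a haΔ))
    calc 2 ≤ a := (Nat.prime_of_mem_primeFactors haΔ).two_le
      _ ≤ a ^ (Δ.factorization a / G) := Nat.le_self_pow (by omega) a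
      _ ≤ k := Finset.single_le_prod' hterm haΔ
  exact ⟨k, hk2, hΔk⟩

/-- **Conditional discharge of `stub_depthSemistable` (registered sub-goal
`stub_depthSemistable_of_mestreOesterle`).** From Mestre–Oesterlé's Théorème 1 (the named fact
`Literature.NumberTheory.EllipticCurves.mestreOesterle1989_thm_1`: `E/ℚ` semistable,
`Δ_min = k^m` with `k ≥ 2` `⟹ m ≤ 5`): for `N` squarefree `E` is semistable
(`WeierstrassCurve.isSemistable_iff_squarefree_conductorNorm`, Silverman ATAEC IV.10.2) and
`Δ_min = k^G`, `k ≥ 2` (`depthSemistable_pow`), hence the depth `G ≤ 5`.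
[cite: MestreOesterle1989, §4 Théorème 1 (p. 176)] -/
theorem stub_depthSemistable_of_mestreOesterle :
    Literature.NumberTheory.EllipticCurves.mestreOesterle1989_thm_1 → ∀ (W : WeierstrassCurve ℚ) [W.IsElliptic], Squarefree (W.conductorNorm ℤ) → ((W.conductorNorm ℤ).primeFactors.filter (fun p => ¬ p ^ 2 ∣ W.conductorNorm ℤ)).Nonempty → ((W.conductorNorm ℤ).primeFactors.filter (fun p => ¬ p ^ 2 ∣ W.conductorNorm ℤ)).gcd (fun p => (W.minimalDiscriminantNorm ℤ).factorization p) ≤ 5 := by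
  intro hMO W _ hsq hS
  obtain ⟨k, hk2, hΔk⟩ := depthSemistable_pow W hsq hS
  exact hMO W ((W.isSemistable_iff_squarefree_conductorNorm).mpr hsq) _ k hk2 hΔk

/-- **The prime-conductor face, modulo the weaker named fact (registered sub-goal
`depthSemistable_prime_of_factorization_le_five`).** If `N_E = p` is prime then the only
multiplicative prime is `p` (`primeFactors p = {p}`, `p² ∤ p`), so the depth is
`G = gcd {c_p} = c_p = v_p(Δ_min) ≤ 5` by Mestre–Oesterlé for prime conductor (the named fact
`Literature.NumberTheory.EllipticCurves.mestreOesterle_factorization_le_five`, itself one line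
from Théorème 1: `mestreOesterle1989_thm_1.factorization_le_five`).
[cite: MestreOesterle1989, §4 Théorème 1 (p. 176) and §5 Théorème 2 (p. 183)] -/
theorem depthSemistable_prime_of_factorization_le_five :
    Literature.NumberTheory.EllipticCurves.mestreOesterle_factorization_le_five → ∀ (W : WeierstrassCurve ℚ) [W.IsElliptic], (W.conductorNorm ℤ).Prime → ((W.conductorNorm ℤ).primeFactors.filter (fun p => ¬ p ^ 2 ∣ W.conductorNorm ℤ)).gcd (fun p => (W.minimalDiscriminantNorm ℤ).factorization p) ≤ 5 := by
  intro h5 W _ hp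
  have hfilter : (W.conductorNorm ℤ).primeFactors.filter (fun p => ¬ p ^ 2 ∣ W.conductorNorm ℤ) =
      {W.conductorNorm ℤ} := by
    rw [depthSemistable_filter_eq W hp.squarefree, hp.primeFactors]
  rw [hfilter, Finset.gcd_singleton, normalize_eq]
  exact h5 W hp

end Summit.ABC.ABC.Theorems.FewPrimeValuationProduct
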